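import Literature.MathematicalPhysics.QuantumLattice.CanonicalVariationalPressure
import Literature.MathematicalPhysics.QuantumLattice.TIStateMeanEntropy
import Literature.MathematicalPhysics.QuantumLattice.TIGroundEnergyDensityCouplingFamilies
import Literature.MathematicalPhysics.QuantumLattice.InfVolFermionStateMixture
import Literature.MathematicalPhysics.QuantumLattice.HubbardTTPrimeThermalPhaseCoexistenceCanonical
import HarnessLib

/-!
# Macroscopic phase coexistence in the DENSITY, model-free, at `T = 0` AND `T > 0`: a ground state / canonical
# equilibrium state that is a mixture of two phases of different densities forces an affine piece of
# `ρ ↦ e_ρ(Ψ)` / `ρ ↦ P(β,Ψ;ρ)`; one certified strict convexity / concavity defect EXCLUDES it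

Topic `Literature/MathematicalPhysics/QuantumLattice` (general `d`, ANY finite-range lattice-fermion interaction `Ψ` on `ℤ^d`:
`t–t'–t''` and strained Hubbard models, bilayers / stacks, extended Hubbard, the three-band Emery model, the `t–t'` model in a
ZEEMAN FIELD `gcInteractionTT' t t' U 0 h`, …). The two variational numbers of the tree at fixed density `ρ`:

* `T = 0`: `e_ρ(Ψ) = Ψ.tiGroundEnergyDensityAt R ρ = inf {e_Ψ(ω) : ω translation invariant, ρ(ω) = ρ}` (CONVEX in `ρ`,
  `FermionInteraction.convexOn_tiGroundEnergyDensityAt`, Ruelle 1969 §3.4);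
* `T ≥ 0`: `P(β,Ψ;ρ) = Ψ.varPressureAt β R ρ = sup {s̄(ω) − β e_Ψ(ω) : ω translation invariant, ρ(ω) = ρ}` (the canonical
  variational pressure of `CanonicalVariationalPressure`; for the `t–t'` Hubbard model it IS `pressureTT'`,
  `varPressureAt_hubbardTTPrime_eq`, and in a Zeeman field it is `pressureTT'Zeeman`, `varPressureAt_gcInteractionTT'_field_eq_pressureTT'Zeeman`).

A translation-invariant state `ω` of density `ρ` is a GROUND STATE at its density if `e_Ψ(ω) = e_ρ(Ψ)`, a CANONICAL EQUILIBRIUM STATE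
at its density if `s̄(ω) − β e_Ψ(ω) = P(β,Ψ;ρ)`; it describes MACROSCOPIC COEXISTENCE of two phases if it is a non-trivial mixture
`λω₁ + (1−λ)ω₂` (`InfVolFermionState.mix`) of translation-invariant states of different densities. PROVED:

* §A (`T = 0`, every `d`, every `Ψ`, `R`): realised densities between two states (`exists_isTranslationInvariant_density_eq_of_mem_uIcc`)
  and convexity of `e_ρ` on that segment; coexistence forces the CHORD IDENTITY `e_{λρ₁+(1−λ)ρ₂} = λe_{ρ₁} + (1−λ)e_{ρ₂}`, both
  components are ground states, and `e` is AFFINE on `[ρ(ω₁), ρ(ω₂)]` (`…_eq_chord_on_segment_of_mix_le`, real analysis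
  `convexOn_affine_of_eq_convexComb`); EXCLUSION READINGS: a strict-convexity defect at the mixture's weights, its certified CAP/FLOORS form
  (`c < λf₁ + (1−λ)f₂`), the SUPER-SEGMENT form (one defect at `(n₁, a n₁ + b n₂, n₂)` excludes coexistence of every pair with
  `ρ(ω₁) ≤ n₁ < n₂ ≤ ρ(ω₂)`, `affine_subchord_of_eq_chord`) and the ENERGY GAP of the phase-separated state.
* §B (`T ≥ 0`, `d ≥ 1`, every `Ψ`, `R`, every real `β`): CONCAVITY of `ρ ↦ P(β,Ψ;ρ)` on realised densities
  (`FermionInteraction.convexComb_varPressureAt_le`, `concaveOn_varPressureAt`: mix near-maximisers — the mean entropy is AFFINE,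
  `entropyDensitySup_mix`, Araki–Moriya — and the mean energy is affine); a canonical equilibrium state that is a mixture forces the chord
  identity for `P`, both components are equilibrium states at their densities, and `P` is AFFINE on the segment
  (`concaveOn_affine_of_eq_convexComb`); EXCLUSION READINGS: strict concavity at the weights; certified form «pressure FLOOR at the mean
  density above the chord of pressure CAPS at the outer densities» (`λQ₁ + (1−λ)Q₂ < W`); the super-segment form; and the PRESSURE GAP
  `s̄(mix) − βe(mix) ≤ λQ₁ + (1−λ)Q₂` of the phase-separated state.

The `t–t'` files `HubbardTTPrimePhaseCoexistenceExclusion` (`T = 0`, `energyDensityTT'`) and `HubbardTTPrimeThermalPhaseCoexistenceCanonical`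
(`T > 0`, sector-Gibbs torus limits and `pressureTT'`) are the instances of record for the one-band model at zero field; the charge-family
`T = 0` law is `TIClassPhaseCoexistenceExclusion`. THIS file is the single-density law for both temperatures and every model, written for the
FIELD axis of the competing-orders word (`HubbardTTPrimePhaseCoexistenceExclusionZeeman`).

HONEST SCOPE: statements about translation-invariant states and two-component convex decompositions; periodic / finite-period states carry
ONE density and are not excluded; nothing identifies `e_ρ` / `P(ρ)` with torus objects here (the tree has that for the `t–t'` model).
Everything is PROVED; no definition, no named fact, no number. Written 2026-08-28 by hubbard-downfold-unc-2 (g21; cell `pub/hubbard-downfold`,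
MO-S1 ↔ S2 seam, filling direction).

## Mathlib / tree search
REUSED: `FermionInteraction.tiGroundEnergyDensityAt_le_meanEnergy`, `tiGroundEnergyDensityAt_convex_comb_le`, `convexOn_tiGroundEnergyDensityAt`
(`TIGroundEnergyDensityCouplingFamilies`); `FermionInteraction.varPressureAt`, `sub_mul_le_varPressureAt`, `varPressureAt_le`
(`CanonicalVariationalPressure`); `InfVolFermionState.entropyDensitySup_mix` (`TIStateMeanEntropy`); `meanEnergy_mix`, `density_mix`,
`IsTranslationInvariant.mix`, `exists_isTranslationInvariant_density_eq_meanEnergy_eq` (`InfVolFermionState(Mixture)`);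
`convexOn_affine_of_eq_convexComb`, `affine_subchord_of_eq_chord` (`HubbardTTPrimePhaseCoexistenceExclusion`), `concaveOn_affine_of_eq_convexComb`
(`HubbardTTPrimeThermalPhaseCoexistenceCanonical`); Mathlib `exists_lt_of_lt_csSup`, `le_of_forall_pos_le_add`, `Set.convex_uIcc`.
`lean search 'varPressureAt.*mix|tiGroundEnergyDensityAt.*mix|coexist'` (2026-08-28): only the `t–t'` instances and the charge-family `T = 0` law.

## References
* R. B. Israel, *Convexity in the Theory of Lattice Gases* (1979), Thm. I.2.4, Lemma II.3.1. [cite: Israel1979, Thm. I.2.4]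
* D. Ruelle, *Statistical Mechanics: Rigorous Results* (1969), §3.4. [cite: Ruelle1969, §3.4]
* H. Araki, H. Moriya, Rev. Math. Phys. 15 (2003) 93, Thm. 3.8, §10, Thm. 12.11. [cite: ArakiMoriya2003, Theorem 3.8 and §10]
* V. J. Emery, S. A. Kivelson, H. Q. Lin, Phys. Rev. Lett. 64 (1990) 475. [cite: EmeryKivelsonLin1990, pp. 475–476]
-/

noncomputable section

open scoped ComplexOrder BigOperators

namespace Literature.MathematicalPhysics.QuantumLattice

open InfVolFermionState FermionInteraction Set

/-! ## §A  `T = 0`: the density-constrained ground-state energy `e_ρ(Ψ) = Ψ.tiGroundEnergyDensityAt R ρ` -/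

namespace InfVolFermionState

variable {d : ℕ} (Ψ : FermionInteraction d) (R : ℝ) {ω₁ ω₂ : InfVolFermionState d}

/-- **Realised densities between two states.** If `ω₁, ω₂` are translation invariant, every `ρ ∈ [ρ(ω₁), ρ(ω₂)]` is the density
of a translation-invariant state (a mixture of the two). [cite: Ruelle1969, §3.4] -/
theorem exists_isTranslationInvariant_density_eq_of_mem_Icc (h₁ : ω₁.IsTranslationInvariant) (h₂ : ω₂.IsTranslationInvariant)
    {ρ : ℝ} (hρ : ρ ∈ Set.Icc ω₁.density ω₂.density) :
    ∃ σ : InfVolFermionState d, σ.IsTranslationInvariant ∧ σ.density = ρ := by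
  rcases eq_or_lt_of_le (hρ.1.trans hρ.2) with heq | hlt
  · exact ⟨ω₁, h₁, le_antisymm hρ.1 (hρ.2.trans heq.ge)⟩
  · obtain ⟨σ, hσ, hσρ, -⟩ := exists_isTranslationInvariant_density_eq_meanEnergy_eq h₁ h₂ rfl rfl hlt hρ.1 hρ.2
    exact ⟨σ, hσ, hσρ⟩

/-- **Realised densities between two states, unordered form**: every `ρ` in the unordered interval `[[ρ(ω₁), ρ(ω₂)]]` is the density
of a translation-invariant state. [cite: Ruelle1969, §3.4] -/
theorem exists_isTranslationInvariant_density_eq_of_mem_uIcc (h₁ : ω₁.IsTranslationInvariant) (h₂ : ω₂.IsTranslationInvariant)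
    {ρ : ℝ} (hρ : ρ ∈ Set.uIcc ω₁.density ω₂.density) :
    ∃ σ : InfVolFermionState d, σ.IsTranslationInvariant ∧ σ.density = ρ := by
  rcases le_total ω₁.density ω₂.density with hle | hle
  · rw [Set.uIcc_of_le hle] at hρ
    exact exists_isTranslationInvariant_density_eq_of_mem_Icc h₁ h₂ hρ
  · rw [Set.uIcc_of_ge hle] at hρ
    exact exists_isTranslationInvariant_density_eq_of_mem_Icc h₂ h₁ hρ

/-- **`e_ρ(Ψ)` is convex on the density segment spanned by two translation-invariant states** (every density there is realised).
[cite: Ruelle1969, §3.4] -/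
theorem IsTranslationInvariant.convexOn_tiGroundEnergyDensityAt_uIcc (h₁ : ω₁.IsTranslationInvariant)
    (h₂ : ω₂.IsTranslationInvariant) :
    ConvexOn ℝ (Set.uIcc ω₁.density ω₂.density) (Ψ.tiGroundEnergyDensityAt R) :=
  Ψ.convexOn_tiGroundEnergyDensityAt R (convex_uIcc _ _)
    fun _ hρ => exists_isTranslationInvariant_density_eq_of_mem_uIcc h₁ h₂ hρ

/-- **Phase coexistence at `T = 0` forces the chord identity (model-free).** Let `ω₁, ω₂` be translation invariant, `0 ≤ λ ≤ 1`, and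
suppose the mixture `ω = λω₁ + (1−λ)ω₂` is a GROUND STATE AT ITS DENSITY: `e_Ψ(ω) ≤ e_{ρ(ω)}(Ψ)` (hence `=`). Then
`e_{λρ₁+(1−λ)ρ₂}(Ψ) = λ e_{ρ₁}(Ψ) + (1−λ) e_{ρ₂}(Ψ)`. [cite: Israel1979, Thm. I.2.4] [cite: Ruelle1969, §3.4] -/
theorem IsTranslationInvariant.tiGroundEnergyDensityAt_eq_convexComb_of_mix_le (h₁ : ω₁.IsTranslationInvariant)
    (h₂ : ω₂.IsTranslationInvariant) {lam : ℝ} (hl0 : 0 ≤ lam) (hl1 : lam ≤ 1)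
    (hGS : (InfVolFermionState.mix lam hl0 hl1 ω₁ ω₂).meanEnergy Ψ R ≤ Ψ.tiGroundEnergyDensityAt R (InfVolFermionState.mix lam hl0 hl1 ω₁ ω₂).density) :
    Ψ.tiGroundEnergyDensityAt R (lam * ω₁.density + (1 - lam) * ω₂.density) =
      lam * Ψ.tiGroundEnergyDensityAt R ω₁.density + (1 - lam) * Ψ.tiGroundEnergyDensityAt R ω₂.density := by
  have hv₁ := Ψ.tiGroundEnergyDensityAt_le_meanEnergy R h₁ rfl
  have hv₂ := Ψ.tiGroundEnergyDensityAt_le_meanEnergy R h₂ rfl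
  have hconv := Ψ.tiGroundEnergyDensityAt_convex_comb_le R ⟨ω₁, h₁, rfl⟩ ⟨ω₂, h₂, rfl⟩ hl0 (by linarith : 0 ≤ 1 - lam)
    (by ring)
  rw [density_mix, meanEnergy_mix] at hGS
  refine le_antisymm hconv ?_
  have k1 := mul_le_mul_of_nonneg_left hv₁ hl0
  have k2 := mul_le_mul_of_nonneg_left hv₂ (by linarith : 0 ≤ 1 - lam)
  linarith

/-- **… and the first component is a ground state at its density** (`0 < λ`): `e_Ψ(ω₁) = e_{ρ(ω₁)}(Ψ)`. [cite: Israel1979, Thm. I.2.4] -/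
theorem IsTranslationInvariant.meanEnergy_eq_tiGroundEnergyDensityAt_of_mix_le_left (h₁ : ω₁.IsTranslationInvariant)
    (h₂ : ω₂.IsTranslationInvariant) {lam : ℝ} (hl0 : 0 < lam) (hl1 : lam ≤ 1)
    (hGS : (InfVolFermionState.mix lam hl0.le hl1 ω₁ ω₂).meanEnergy Ψ R ≤ Ψ.tiGroundEnergyDensityAt R (InfVolFermionState.mix lam hl0.le hl1 ω₁ ω₂).density) :
    ω₁.meanEnergy Ψ R = Ψ.tiGroundEnergyDensityAt R ω₁.density := by
  have hv₁ := Ψ.tiGroundEnergyDensityAt_le_meanEnergy R h₁ rfl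
  have hv₂ := Ψ.tiGroundEnergyDensityAt_le_meanEnergy R h₂ rfl
  have hconv := Ψ.tiGroundEnergyDensityAt_convex_comb_le R ⟨ω₁, h₁, rfl⟩ ⟨ω₂, h₂, rfl⟩ hl0.le (by linarith : 0 ≤ 1 - lam)
    (by ring)
  rw [density_mix, meanEnergy_mix] at hGS
  refine le_antisymm ?_ hv₁
  have k2 := mul_le_mul_of_nonneg_left hv₂ (by linarith : 0 ≤ 1 - lam)
  by_contra hlt
  have hlt' := lt_of_not_ge hlt
  have k1 : lam * Ψ.tiGroundEnergyDensityAt R ω₁.density < lam * ω₁.meanEnergy Ψ R := mul_lt_mul_of_pos_left hlt' hl0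
  linarith

/-- **… and the second component is a ground state at its density** (`λ < 1`): `e_Ψ(ω₂) = e_{ρ(ω₂)}(Ψ)`. [cite: Israel1979, Thm. I.2.4] -/
theorem IsTranslationInvariant.meanEnergy_eq_tiGroundEnergyDensityAt_of_mix_le_right (h₁ : ω₁.IsTranslationInvariant)
    (h₂ : ω₂.IsTranslationInvariant) {lam : ℝ} (hl0 : 0 ≤ lam) (hl1 : lam < 1)
    (hGS : (InfVolFermionState.mix lam hl0 hl1.le ω₁ ω₂).meanEnergy Ψ R ≤ Ψ.tiGroundEnergyDensityAt R (InfVolFermionState.mix lam hl0 hl1.le ω₁ ω₂).density) :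
    ω₂.meanEnergy Ψ R = Ψ.tiGroundEnergyDensityAt R ω₂.density := by
  have hv₁ := Ψ.tiGroundEnergyDensityAt_le_meanEnergy R h₁ rfl
  have hv₂ := Ψ.tiGroundEnergyDensityAt_le_meanEnergy R h₂ rfl
  have hconv := Ψ.tiGroundEnergyDensityAt_convex_comb_le R ⟨ω₁, h₁, rfl⟩ ⟨ω₂, h₂, rfl⟩ hl0 (by linarith : 0 ≤ 1 - lam)
    (by ring)
  rw [density_mix, meanEnergy_mix] at hGS
  refine le_antisymm ?_ hv₂
  have k1 := mul_le_mul_of_nonneg_left hv₁ hl0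
  by_contra hlt
  have hlt' := lt_of_not_ge hlt
  have k2 : (1 - lam) * Ψ.tiGroundEnergyDensityAt R ω₂.density < (1 - lam) * ω₂.meanEnergy Ψ R :=
    mul_lt_mul_of_pos_left hlt' (by linarith)
  linarith

/-- **Coexistence makes `e_ρ(Ψ)` affine on the whole segment `[ρ(ω₁), ρ(ω₂)]`** (`0 < λ < 1`): for all `p, q ≥ 0`, `p + q = 1`,
`e_{pρ₁+qρ₂}(Ψ) = p e_{ρ₁}(Ψ) + q e_{ρ₂}(Ψ)`. [cite: Israel1979, Thm. I.2.4] -/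
theorem IsTranslationInvariant.tiGroundEnergyDensityAt_eq_chord_on_segment_of_mix_le (h₁ : ω₁.IsTranslationInvariant)
    (h₂ : ω₂.IsTranslationInvariant) {lam : ℝ} (hl0 : 0 < lam) (hl1 : lam < 1)
    (hGS : (InfVolFermionState.mix lam hl0.le hl1.le ω₁ ω₂).meanEnergy Ψ R ≤ Ψ.tiGroundEnergyDensityAt R (InfVolFermionState.mix lam hl0.le hl1.le ω₁ ω₂).density)
    {p q : ℝ} (hp : 0 ≤ p) (hq : 0 ≤ q) (hpq : p + q = 1) :
    Ψ.tiGroundEnergyDensityAt R (p * ω₁.density + q * ω₂.density) =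
      p * Ψ.tiGroundEnergyDensityAt R ω₁.density + q * Ψ.tiGroundEnergyDensityAt R ω₂.density := by
  have heq := h₁.tiGroundEnergyDensityAt_eq_convexComb_of_mix_le Ψ R h₂ hl0.le hl1.le hGS
  exact convexOn_affine_of_eq_convexComb (h₁.convexOn_tiGroundEnergyDensityAt_uIcc Ψ R h₂) Set.left_mem_uIcc
    Set.right_mem_uIcc hl0 (by linarith) (by ring) heq hp hq hpq

/-- **Strict convexity at the mixture's weights excludes coexistence (model-free, `T = 0`).** If
`e_{λρ₁+(1−λ)ρ₂}(Ψ) < λ e_{ρ₁}(Ψ) + (1−λ) e_{ρ₂}(Ψ)` then the mixture `λω₁ + (1−λ)ω₂` of ANY translation-invariant states of densities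
`ρ₁, ρ₂` is NOT a ground state at its density: its mean energy exceeds `e_{ρ(mix)}(Ψ)`. [cite: Israel1979, Thm. I.2.4]
[cite: EmeryKivelsonLin1990, pp. 475–476] -/
theorem IsTranslationInvariant.tiGroundEnergyDensityAt_lt_meanEnergy_mix_of_lt_convexComb (h₁ : ω₁.IsTranslationInvariant)
    (h₂ : ω₂.IsTranslationInvariant) {lam : ℝ} (hl0 : 0 ≤ lam) (hl1 : lam ≤ 1)
    (hstrict : Ψ.tiGroundEnergyDensityAt R (lam * ω₁.density + (1 - lam) * ω₂.density) <
      lam * Ψ.tiGroundEnergyDensityAt R ω₁.density + (1 - lam) * Ψ.tiGroundEnergyDensityAt R ω₂.density) :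
    Ψ.tiGroundEnergyDensityAt R (InfVolFermionState.mix lam hl0 hl1 ω₁ ω₂).density < (InfVolFermionState.mix lam hl0 hl1 ω₁ ω₂).meanEnergy Ψ R := by
  by_contra hle
  have hle' := le_of_not_gt hle
  have heq := h₁.tiGroundEnergyDensityAt_eq_convexComb_of_mix_le Ψ R h₂ hl0 hl1 hle'
  linarith

/-- **Certified exclusion from energy windows (model-free, `T = 0`).** A CAP `e_{λρ₁+(1−λ)ρ₂}(Ψ) ≤ c` and FLOORS `f₁ ≤ e_{ρ₁}(Ψ)`,
`f₂ ≤ e_{ρ₂}(Ψ)` with `c < λf₁ + (1−λ)f₂` exclude coexistence of the densities `ρ₁ = ρ(ω₁)`, `ρ₂ = ρ(ω₂)` at the weight `λ`.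
[cite: EmeryKivelsonLin1990, pp. 475–476] -/
theorem IsTranslationInvariant.tiGroundEnergyDensityAt_lt_meanEnergy_mix_of_cap_lt_floors (h₁ : ω₁.IsTranslationInvariant)
    (h₂ : ω₂.IsTranslationInvariant) {lam : ℝ} (hl0 : 0 ≤ lam) (hl1 : lam ≤ 1) {c f₁ f₂ : ℝ}
    (hcap : Ψ.tiGroundEnergyDensityAt R (lam * ω₁.density + (1 - lam) * ω₂.density) ≤ c)
    (hf₁ : f₁ ≤ Ψ.tiGroundEnergyDensityAt R ω₁.density) (hf₂ : f₂ ≤ Ψ.tiGroundEnergyDensityAt R ω₂.density)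
    (hc : c < lam * f₁ + (1 - lam) * f₂) :
    Ψ.tiGroundEnergyDensityAt R (InfVolFermionState.mix lam hl0 hl1 ω₁ ω₂).density < (InfVolFermionState.mix lam hl0 hl1 ω₁ ω₂).meanEnergy Ψ R := by
  refine h₁.tiGroundEnergyDensityAt_lt_meanEnergy_mix_of_lt_convexComb Ψ R h₂ hl0 hl1 ?_
  have k1 := mul_le_mul_of_nonneg_left hf₁ hl0
  have k2 := mul_le_mul_of_nonneg_left hf₂ (by linarith : 0 ≤ 1 - lam)
  linarith

/-- **Super-segment exclusion (model-free, `T = 0`).** One strict-convexity defect `e_{an₁+bn₂}(Ψ) < a e_{n₁}(Ψ) + b e_{n₂}(Ψ)`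
(`a, b ≥ 0`, `a + b = 1`, `n₁ < n₂`) excludes macroscopic coexistence of EVERY pair of translation-invariant states with densities
`ρ(ω₁) ≤ n₁` and `n₂ ≤ ρ(ω₂)`: for every `0 < λ < 1` the mixture has mean energy STRICTLY above `e` at its density (an affine piece
`[ρ(ω₁), ρ(ω₂)] ⊇ [n₁, n₂]` would force equality in Jensen at `an₁ + bn₂`). [cite: Israel1979, Thm. I.2.4] [cite: EmeryKivelsonLin1990, pp. 475–476] -/
theorem IsTranslationInvariant.tiGroundEnergyDensityAt_lt_meanEnergy_mix_of_strict_at_of_le (h₁ : ω₁.IsTranslationInvariant)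
    (h₂ : ω₂.IsTranslationInvariant) {n₁ n₂ : ℝ} (hn₁ : ω₁.density ≤ n₁) (hn : n₁ < n₂) (hn₂ : n₂ ≤ ω₂.density)
    {a b : ℝ} (ha : 0 ≤ a) (hb : 0 ≤ b) (hab : a + b = 1)
    (hstrict : Ψ.tiGroundEnergyDensityAt R (a * n₁ + b * n₂) <
      a * Ψ.tiGroundEnergyDensityAt R n₁ + b * Ψ.tiGroundEnergyDensityAt R n₂)
    {lam : ℝ} (hl0 : 0 < lam) (hl1 : lam < 1) :
    Ψ.tiGroundEnergyDensityAt R (InfVolFermionState.mix lam hl0.le hl1.le ω₁ ω₂).density < (InfVolFermionState.mix lam hl0.le hl1.le ω₁ ω₂).meanEnergy Ψ R := by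
  by_contra hle
  have hle' := le_of_not_gt hle
  have haff : ∀ {p q : ℝ}, 0 ≤ p → 0 ≤ q → p + q = 1 →
      Ψ.tiGroundEnergyDensityAt R (p * ω₁.density + q * ω₂.density) =
        p * Ψ.tiGroundEnergyDensityAt R ω₁.density + q * Ψ.tiGroundEnergyDensityAt R ω₂.density :=
    fun hp hq hpq => h₁.tiGroundEnergyDensityAt_eq_chord_on_segment_of_mix_le Ψ R h₂ hl0 hl1 hle' hp hq hpq
  have heq := affine_subchord_of_eq_chord (f := Ψ.tiGroundEnergyDensityAt R) (by linarith) haff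
    hn₁ (by linarith) (by linarith) hn₂ ha hb hab
  exact absurd heq (ne_of_lt hstrict)

/-- **Certified super-segment exclusion from energy windows (model-free, `T = 0`).** A CAP `e_{an₁+bn₂}(Ψ) ≤ c` and FLOORS
`f₁ ≤ e_{n₁}(Ψ)`, `f₂ ≤ e_{n₂}(Ψ)` with POSITIVE EXCLUSION MARGIN `c < a f₁ + b f₂` (`a, b ≥ 0`, `a + b = 1`, `n₁ < n₂`): no mixture of
translation-invariant states with densities `ρ(ω₁) ≤ n₁`, `n₂ ≤ ρ(ω₂)` is a ground state at ANY mean density.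
[cite: EmeryKivelsonLin1990, pp. 475–476] [cite: Israel1979, Thm. I.2.4] -/
theorem IsTranslationInvariant.tiGroundEnergyDensityAt_lt_meanEnergy_mix_of_cap_lt_floors_of_le (h₁ : ω₁.IsTranslationInvariant)
    (h₂ : ω₂.IsTranslationInvariant) {n₁ n₂ : ℝ} (hn₁ : ω₁.density ≤ n₁) (hn : n₁ < n₂) (hn₂ : n₂ ≤ ω₂.density)
    {a b : ℝ} (ha : 0 ≤ a) (hb : 0 ≤ b) (hab : a + b = 1) {c f₁ f₂ : ℝ}
    (hcap : Ψ.tiGroundEnergyDensityAt R (a * n₁ + b * n₂) ≤ c)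
    (hf₁ : f₁ ≤ Ψ.tiGroundEnergyDensityAt R n₁) (hf₂ : f₂ ≤ Ψ.tiGroundEnergyDensityAt R n₂) (hc : c < a * f₁ + b * f₂)
    {lam : ℝ} (hl0 : 0 < lam) (hl1 : lam < 1) :
    Ψ.tiGroundEnergyDensityAt R (InfVolFermionState.mix lam hl0.le hl1.le ω₁ ω₂).density < (InfVolFermionState.mix lam hl0.le hl1.le ω₁ ω₂).meanEnergy Ψ R := by
  refine h₁.tiGroundEnergyDensityAt_lt_meanEnergy_mix_of_strict_at_of_le Ψ R h₂ hn₁ hn hn₂ ha hb hab ?_ hl0 hl1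
  have k1 := mul_le_mul_of_nonneg_left hf₁ ha
  have k2 := mul_le_mul_of_nonneg_left hf₂ hb
  linarith

/-- **Mean energy of a mixture from certified floors** (`0 ≤ λ ≤ 1`): `λf₁ + (1−λ)f₂ ≤ e_Ψ(λω₁ + (1−λ)ω₂)` whenever
`f_i ≤ e_{ρ(ω_i)}(Ψ)` (`e_Ψ` is affine; each component obeys the variational principle). [cite: Ruelle1969, §3.4] -/
theorem IsTranslationInvariant.convexComb_floors_le_meanEnergy_mix_of_tiGroundEnergyDensityAt (h₁ : ω₁.IsTranslationInvariant)
    (h₂ : ω₂.IsTranslationInvariant) {f₁ f₂ : ℝ} (hf₁ : f₁ ≤ Ψ.tiGroundEnergyDensityAt R ω₁.density)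
    (hf₂ : f₂ ≤ Ψ.tiGroundEnergyDensityAt R ω₂.density) {lam : ℝ} (hl0 : 0 ≤ lam) (hl1 : lam ≤ 1) :
    lam * f₁ + (1 - lam) * f₂ ≤ (InfVolFermionState.mix lam hl0 hl1 ω₁ ω₂).meanEnergy Ψ R := by
  have hv₁ := Ψ.tiGroundEnergyDensityAt_le_meanEnergy R h₁ rfl
  have hv₂ := Ψ.tiGroundEnergyDensityAt_le_meanEnergy R h₂ rfl
  rw [meanEnergy_mix]
  have k1 := mul_le_mul_of_nonneg_left (hf₁.trans hv₁) hl0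
  have k2 := mul_le_mul_of_nonneg_left (hf₂.trans hv₂) (by linarith : 0 ≤ 1 - lam)
  linarith

/-- **Energy gap of the phase-separated state (model-free, `T = 0`)**: with, in addition, a CAP `e_{ρ(mix)}(Ψ) ≤ c` at the mixture's
density, `e_{ρ(mix)}(Ψ) + (λf₁ + (1−λ)f₂ − c) ≤ e_Ψ(mixture)` — the mixture lies at least the EXCLUSION MARGIN above the ground-state energy
density at its own density. [cite: EmeryKivelsonLin1990, pp. 475–476] -/
theorem IsTranslationInvariant.tiGroundEnergyDensityAt_add_margin_le_meanEnergy_mix (h₁ : ω₁.IsTranslationInvariant)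
    (h₂ : ω₂.IsTranslationInvariant) {c f₁ f₂ : ℝ} (hf₁ : f₁ ≤ Ψ.tiGroundEnergyDensityAt R ω₁.density)
    (hf₂ : f₂ ≤ Ψ.tiGroundEnergyDensityAt R ω₂.density) {lam : ℝ} (hl0 : 0 ≤ lam) (hl1 : lam ≤ 1)
    (hcap : Ψ.tiGroundEnergyDensityAt R (lam * ω₁.density + (1 - lam) * ω₂.density) ≤ c) :
    Ψ.tiGroundEnergyDensityAt R (InfVolFermionState.mix lam hl0 hl1 ω₁ ω₂).density + (lam * f₁ + (1 - lam) * f₂ - c) ≤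
      (InfVolFermionState.mix lam hl0 hl1 ω₁ ω₂).meanEnergy Ψ R := by
  have h := h₁.convexComb_floors_le_meanEnergy_mix_of_tiGroundEnergyDensityAt Ψ R h₂ hf₁ hf₂ hl0 hl1
  rw [density_mix]
  linarith

end InfVolFermionState

/-! ## §B  `T ≥ 0`: the canonical variational pressure `P(β,Ψ;ρ) = Ψ.varPressureAt β R ρ` -/

namespace FermionInteraction

variable {d : ℕ} (hd : 0 < d) (β : ℝ) (Ψ : FermionInteraction d) (R : ℝ)

/-- **Near-maximisers at fixed density**: if the density `ρ` is realised and `c < P(β,Ψ;ρ)`, some translation-invariant `ω` of density `ρ`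
has `c < s̄(ω) − β e_Ψ(ω)`. [cite: Israel1979, Lemma II.3.1] -/
theorem exists_lt_sub_mul_of_lt_varPressureAt {ρ c : ℝ}
    (hne : ∃ ω : InfVolFermionState d, ω.IsTranslationInvariant ∧ ω.density = ρ) (hc : c < Ψ.varPressureAt β R ρ) :
    ∃ ω : InfVolFermionState d, ω.IsTranslationInvariant ∧ ω.density = ρ ∧
      c < ω.entropyDensitySup - β * ω.meanEnergy Ψ R := by
  obtain ⟨ω₀, hω₀, hρ₀⟩ := hne
  have hne' : ((fun ω : InfVolFermionState d => ω.entropyDensitySup - β * ω.meanEnergy Ψ R) ''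
      {ω : InfVolFermionState d | ω.IsTranslationInvariant ∧ ω.density = ρ}).Nonempty :=
    ⟨_, Set.mem_image_of_mem _ (show ω₀ ∈ {ω : InfVolFermionState d | ω.IsTranslationInvariant ∧ ω.density = ρ} from ⟨hω₀, hρ₀⟩)⟩
  have hc' : c < sSup ((fun ω : InfVolFermionState d => ω.entropyDensitySup - β * ω.meanEnergy Ψ R) ''
      {ω : InfVolFermionState d | ω.IsTranslationInvariant ∧ ω.density = ρ}) := hc
  obtain ⟨x, ⟨ω, ⟨hω, hρ⟩, rfl⟩, hx⟩ := exists_lt_of_lt_csSup hne' hc'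
  exact ⟨ω, hω, hρ, hx⟩

include hd in
/-- **CONCAVITY OF THE CANONICAL VARIATIONAL PRESSURE IN THE DENSITY, three-point form** (`d ≥ 1`, any real `β`). For realised
densities `ρ₁, ρ₂` and `a, b ≥ 0`, `a + b = 1`: `a P(β,Ψ;ρ₁) + b P(β,Ψ;ρ₂) ≤ P(β,Ψ; aρ₁ + bρ₂)` — mix near-maximisers: the state space is
convex, the density and the mean energy are affine (`density_mix`, `meanEnergy_mix`) and SO IS THE MEAN ENTROPY (`entropyDensitySup_mix`).
[cite: Israel1979, Thm. I.2.4] [cite: ArakiMoriya2003, Theorem 3.8 and §10] -/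
theorem convexComb_varPressureAt_le {ρ₁ ρ₂ : ℝ}
    (h₁ : ∃ ω : InfVolFermionState d, ω.IsTranslationInvariant ∧ ω.density = ρ₁)
    (h₂ : ∃ ω : InfVolFermionState d, ω.IsTranslationInvariant ∧ ω.density = ρ₂)
    {a b : ℝ} (ha : 0 ≤ a) (hb : 0 ≤ b) (hab : a + b = 1) :
    a * Ψ.varPressureAt β R ρ₁ + b * Ψ.varPressureAt β R ρ₂ ≤ Ψ.varPressureAt β R (a * ρ₁ + b * ρ₂) := by
  refine le_of_forall_pos_le_add fun ε hε => ?_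
  obtain ⟨ω₁, hω₁, hρ₁, he₁⟩ := Ψ.exists_lt_sub_mul_of_lt_varPressureAt β R h₁ (sub_lt_self (Ψ.varPressureAt β R ρ₁) hε)
  obtain ⟨ω₂, hω₂, hρ₂, he₂⟩ := Ψ.exists_lt_sub_mul_of_lt_varPressureAt β R h₂ (sub_lt_self (Ψ.varPressureAt β R ρ₂) hε)
  have ha1 : a ≤ 1 := by linarith
  have hTI := hω₁.mix hω₂ a ha ha1
  have hρ : (InfVolFermionState.mix a ha ha1 ω₁ ω₂).density = a * ρ₁ + b * ρ₂ := by
    rw [InfVolFermionState.density_mix, hρ₁, hρ₂, show 1 - a = b by linarith]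
  have hle := Ψ.sub_mul_le_varPressureAt β R (a * ρ₁ + b * ρ₂) hTI hρ
  rw [InfVolFermionState.entropyDensitySup_mix hd a ha ha1 hω₁ hω₂, InfVolFermionState.meanEnergy_mix,
    show 1 - a = b by linarith] at hle
  have k1 := mul_le_mul_of_nonneg_left he₁.le ha
  have k2 := mul_le_mul_of_nonneg_left he₂.le hb
  have hε' : a * ε + b * ε = ε := by rw [← add_mul, hab, one_mul]
  nlinarith [k1, k2, hle, hε']

include hd in
/-- **CONCAVITY OF `ρ ↦ P(β,Ψ;ρ)`** on every convex set of realised densities (the `t–t'` instance is `concaveOn_pressureTT'_density`).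
[cite: Israel1979, Thm. I.2.4] [cite: Ruelle1969, §3.4] -/
theorem concaveOn_varPressureAt {D : Set ℝ} (hD : Convex ℝ D)
    (hne : ∀ ρ ∈ D, ∃ ω : InfVolFermionState d, ω.IsTranslationInvariant ∧ ω.density = ρ) :
    ConcaveOn ℝ D (Ψ.varPressureAt β R) := by
  refine ⟨hD, fun x hx y hy a b ha hb hab => ?_⟩
  simp only [smul_eq_mul]
  exact Ψ.convexComb_varPressureAt_le hd β R (hne x hx) (hne y hy) ha hb hab

end FermionInteraction

namespace InfVolFermionState

variable {d : ℕ} (hd : 0 < d) (β : ℝ) (Ψ : FermionInteraction d) (R : ℝ) {ω₁ ω₂ : InfVolFermionState d}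

include hd in
/-- **`P(β,Ψ;·)` is concave on the density segment spanned by two translation-invariant states.** [cite: Israel1979, Thm. I.2.4] -/
theorem IsTranslationInvariant.concaveOn_varPressureAt_uIcc (h₁ : ω₁.IsTranslationInvariant) (h₂ : ω₂.IsTranslationInvariant) :
    ConcaveOn ℝ (Set.uIcc ω₁.density ω₂.density) (Ψ.varPressureAt β R) :=
  Ψ.concaveOn_varPressureAt hd β R (convex_uIcc _ _)
    fun _ hρ => exists_isTranslationInvariant_density_eq_of_mem_uIcc h₁ h₂ hρ

include hd in
/-- **Thermal phase coexistence in the canonical ensemble forces the chord identity (model-free).** Let `ω₁, ω₂` be translation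
invariant, `0 ≤ λ ≤ 1`, and suppose the mixture `ω = λω₁ + (1−λ)ω₂` is a CANONICAL EQUILIBRIUM STATE AT ITS DENSITY:
`P(β,Ψ;ρ(ω)) ≤ s̄(ω) − βe_Ψ(ω)` (hence `=`). Then `P(β,Ψ; λρ₁+(1−λ)ρ₂) = λ P(β,Ψ;ρ₁) + (1−λ) P(β,Ψ;ρ₂)`.
[cite: Israel1979, Thm. I.2.4] [cite: ArakiMoriya2003, Theorem 3.8 and §10] -/
theorem IsTranslationInvariant.varPressureAt_eq_convexComb_of_le_mix (h₁ : ω₁.IsTranslationInvariant)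
    (h₂ : ω₂.IsTranslationInvariant) {lam : ℝ} (hl0 : 0 ≤ lam) (hl1 : lam ≤ 1)
    (hEq : Ψ.varPressureAt β R (InfVolFermionState.mix lam hl0 hl1 ω₁ ω₂).density ≤
      (InfVolFermionState.mix lam hl0 hl1 ω₁ ω₂).entropyDensitySup - β * (InfVolFermionState.mix lam hl0 hl1 ω₁ ω₂).meanEnergy Ψ R) :
    Ψ.varPressureAt β R (lam * ω₁.density + (1 - lam) * ω₂.density) =
      lam * Ψ.varPressureAt β R ω₁.density + (1 - lam) * Ψ.varPressureAt β R ω₂.density := by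
  have hv₁ := Ψ.sub_mul_le_varPressureAt β R ω₁.density h₁ rfl
  have hv₂ := Ψ.sub_mul_le_varPressureAt β R ω₂.density h₂ rfl
  have hconc := Ψ.convexComb_varPressureAt_le hd β R ⟨ω₁, h₁, rfl⟩ ⟨ω₂, h₂, rfl⟩ hl0 (by linarith : 0 ≤ 1 - lam) (by ring)
  rw [density_mix, entropyDensitySup_mix hd lam hl0 hl1 h₁ h₂, meanEnergy_mix] at hEq
  refine le_antisymm ?_ hconc
  have k1 := mul_le_mul_of_nonneg_left hv₁ hl0
  have k2 := mul_le_mul_of_nonneg_left hv₂ (by linarith : 0 ≤ 1 - lam)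
  nlinarith [k1, k2, hEq]

include hd in
/-- **… and the first component is a canonical equilibrium state at its density** (`0 < λ`): `s̄(ω₁) − βe_Ψ(ω₁) = P(β,Ψ;ρ(ω₁))`.
[cite: Israel1979, Thm. I.2.4] -/
theorem IsTranslationInvariant.sub_mul_eq_varPressureAt_of_le_mix_left (h₁ : ω₁.IsTranslationInvariant)
    (h₂ : ω₂.IsTranslationInvariant) {lam : ℝ} (hl0 : 0 < lam) (hl1 : lam ≤ 1)
    (hEq : Ψ.varPressureAt β R (InfVolFermionState.mix lam hl0.le hl1 ω₁ ω₂).density ≤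
      (InfVolFermionState.mix lam hl0.le hl1 ω₁ ω₂).entropyDensitySup - β * (InfVolFermionState.mix lam hl0.le hl1 ω₁ ω₂).meanEnergy Ψ R) :
    ω₁.entropyDensitySup - β * ω₁.meanEnergy Ψ R = Ψ.varPressureAt β R ω₁.density := by
  have hv₁ := Ψ.sub_mul_le_varPressureAt β R ω₁.density h₁ rfl
  have hv₂ := Ψ.sub_mul_le_varPressureAt β R ω₂.density h₂ rfl
  have hconc := Ψ.convexComb_varPressureAt_le hd β R ⟨ω₁, h₁, rfl⟩ ⟨ω₂, h₂, rfl⟩ hl0.le (by linarith : 0 ≤ 1 - lam) (by ring)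
  rw [density_mix, entropyDensitySup_mix hd lam hl0.le hl1 h₁ h₂, meanEnergy_mix] at hEq
  refine le_antisymm hv₁ ?_
  have k2 := mul_le_mul_of_nonneg_left hv₂ (by linarith : 0 ≤ 1 - lam)
  by_contra hlt
  have hlt' := lt_of_not_ge hlt
  have k1 : lam * (ω₁.entropyDensitySup - β * ω₁.meanEnergy Ψ R) < lam * Ψ.varPressureAt β R ω₁.density :=
    mul_lt_mul_of_pos_left hlt' hl0
  nlinarith [k1, k2, hEq, hconc]

include hd in
/-- **… and the second component is a canonical equilibrium state at its density** (`λ < 1`): `s̄(ω₂) − βe_Ψ(ω₂) = P(β,Ψ;ρ(ω₂))`.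
[cite: Israel1979, Thm. I.2.4] -/
theorem IsTranslationInvariant.sub_mul_eq_varPressureAt_of_le_mix_right (h₁ : ω₁.IsTranslationInvariant)
    (h₂ : ω₂.IsTranslationInvariant) {lam : ℝ} (hl0 : 0 ≤ lam) (hl1 : lam < 1)
    (hEq : Ψ.varPressureAt β R (InfVolFermionState.mix lam hl0 hl1.le ω₁ ω₂).density ≤
      (InfVolFermionState.mix lam hl0 hl1.le ω₁ ω₂).entropyDensitySup - β * (InfVolFermionState.mix lam hl0 hl1.le ω₁ ω₂).meanEnergy Ψ R) :
    ω₂.entropyDensitySup - β * ω₂.meanEnergy Ψ R = Ψ.varPressureAt β R ω₂.density := by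
  have hv₁ := Ψ.sub_mul_le_varPressureAt β R ω₁.density h₁ rfl
  have hv₂ := Ψ.sub_mul_le_varPressureAt β R ω₂.density h₂ rfl
  have hconc := Ψ.convexComb_varPressureAt_le hd β R ⟨ω₁, h₁, rfl⟩ ⟨ω₂, h₂, rfl⟩ hl0 (by linarith : 0 ≤ 1 - lam) (by ring)
  rw [density_mix, entropyDensitySup_mix hd lam hl0 hl1.le h₁ h₂, meanEnergy_mix] at hEq
  refine le_antisymm hv₂ ?_
  have k1 := mul_le_mul_of_nonneg_left hv₁ hl0
  by_contra hlt
  have hlt' := lt_of_not_ge hlt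
  have k2 : (1 - lam) * (ω₂.entropyDensitySup - β * ω₂.meanEnergy Ψ R) < (1 - lam) * Ψ.varPressureAt β R ω₂.density :=
    mul_lt_mul_of_pos_left hlt' (by linarith)
  nlinarith [k1, k2, hEq, hconc]

include hd in
/-- **Coexistence makes `P(β,Ψ;·)` affine on the whole segment `[ρ(ω₁), ρ(ω₂)]`** (`0 < λ < 1`): for all `p, q ≥ 0`, `p + q = 1`,
`P(pρ₁ + qρ₂) = p P(ρ₁) + q P(ρ₂)` — thermal phase separation forces a FLAT PIECE of the (concave) pressure–density curve.
[cite: Israel1979, Thm. I.2.4] -/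
theorem IsTranslationInvariant.varPressureAt_eq_chord_on_segment_of_le_mix (h₁ : ω₁.IsTranslationInvariant)
    (h₂ : ω₂.IsTranslationInvariant) {lam : ℝ} (hl0 : 0 < lam) (hl1 : lam < 1)
    (hEq : Ψ.varPressureAt β R (InfVolFermionState.mix lam hl0.le hl1.le ω₁ ω₂).density ≤
      (InfVolFermionState.mix lam hl0.le hl1.le ω₁ ω₂).entropyDensitySup - β * (InfVolFermionState.mix lam hl0.le hl1.le ω₁ ω₂).meanEnergy Ψ R)
    {p q : ℝ} (hp : 0 ≤ p) (hq : 0 ≤ q) (hpq : p + q = 1) :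
    Ψ.varPressureAt β R (p * ω₁.density + q * ω₂.density) =
      p * Ψ.varPressureAt β R ω₁.density + q * Ψ.varPressureAt β R ω₂.density := by
  have heq := h₁.varPressureAt_eq_convexComb_of_le_mix hd β Ψ R h₂ hl0.le hl1.le hEq
  exact concaveOn_affine_of_eq_convexComb (h₁.concaveOn_varPressureAt_uIcc hd β Ψ R h₂) Set.left_mem_uIcc
    Set.right_mem_uIcc hl0 (by linarith) (by ring) heq hp hq hpq

include hd in
/-- **Strict concavity at the mixture's weights excludes thermal coexistence (model-free).** If
`λ P(ρ₁) + (1−λ) P(ρ₂) < P(λρ₁ + (1−λ)ρ₂)` then the mixture `λω₁ + (1−λ)ω₂` of ANY translation-invariant states of densities `ρ₁, ρ₂`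
is NOT a canonical equilibrium state at its density: `s̄(mix) − βe_Ψ(mixture) < P(β,Ψ;ρ(mix))`. [cite: Israel1979, Thm. I.2.4] -/
theorem IsTranslationInvariant.sub_mul_lt_varPressureAt_mix_of_convexComb_lt (h₁ : ω₁.IsTranslationInvariant)
    (h₂ : ω₂.IsTranslationInvariant) {lam : ℝ} (hl0 : 0 ≤ lam) (hl1 : lam ≤ 1)
    (hstrict : lam * Ψ.varPressureAt β R ω₁.density + (1 - lam) * Ψ.varPressureAt β R ω₂.density <
      Ψ.varPressureAt β R (lam * ω₁.density + (1 - lam) * ω₂.density)) :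
    (InfVolFermionState.mix lam hl0 hl1 ω₁ ω₂).entropyDensitySup - β * (InfVolFermionState.mix lam hl0 hl1 ω₁ ω₂).meanEnergy Ψ R <
      Ψ.varPressureAt β R (InfVolFermionState.mix lam hl0 hl1 ω₁ ω₂).density := by
  by_contra hle
  have hle' := le_of_not_gt hle
  have heq := h₁.varPressureAt_eq_convexComb_of_le_mix hd β Ψ R h₂ hl0 hl1 hle'
  linarith

include hd in
/-- **Certified exclusion from pressure windows (model-free): a pressure FLOOR at the mean density above the chord of pressure CAPS.**
`W ≤ P(λρ₁ + (1−λ)ρ₂)`, `P(ρ₁) ≤ Q₁`, `P(ρ₂) ≤ Q₂` and `λQ₁ + (1−λ)Q₂ < W` certify that no mixture `λω₁ + (1−λ)ω₂` of translation-invariant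
states of densities `ρ₁, ρ₂` is a canonical equilibrium state at `(β; ρ(mix))`. [cite: Israel1979, Thm. I.2.4] -/
theorem IsTranslationInvariant.sub_mul_lt_varPressureAt_mix_of_chord_lt_floor (h₁ : ω₁.IsTranslationInvariant)
    (h₂ : ω₂.IsTranslationInvariant) {lam : ℝ} (hl0 : 0 ≤ lam) (hl1 : lam ≤ 1) {W Q₁ Q₂ : ℝ}
    (hW : W ≤ Ψ.varPressureAt β R (lam * ω₁.density + (1 - lam) * ω₂.density))
    (hQ₁ : Ψ.varPressureAt β R ω₁.density ≤ Q₁) (hQ₂ : Ψ.varPressureAt β R ω₂.density ≤ Q₂)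
    (hlt : lam * Q₁ + (1 - lam) * Q₂ < W) :
    (InfVolFermionState.mix lam hl0 hl1 ω₁ ω₂).entropyDensitySup - β * (InfVolFermionState.mix lam hl0 hl1 ω₁ ω₂).meanEnergy Ψ R <
      Ψ.varPressureAt β R (InfVolFermionState.mix lam hl0 hl1 ω₁ ω₂).density := by
  refine h₁.sub_mul_lt_varPressureAt_mix_of_convexComb_lt hd β Ψ R h₂ hl0 hl1 ?_
  have k1 := mul_le_mul_of_nonneg_left hQ₁ hl0
  have k2 := mul_le_mul_of_nonneg_left hQ₂ (by linarith : 0 ≤ 1 - lam)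
  linarith

include hd in
/-- **Super-segment exclusion (model-free, `T ≥ 0`).** One strict-concavity defect `a P(n₁) + b P(n₂) < P(an₁ + bn₂)` (`a, b ≥ 0`,
`a + b = 1`, `n₁ < n₂`) excludes thermal coexistence of EVERY pair of translation-invariant states with densities `ρ(ω₁) ≤ n₁` and
`n₂ ≤ ρ(ω₂)`: for every `0 < λ < 1` the mixture is not a canonical equilibrium state at its density (a flat piece `[ρ(ω₁), ρ(ω₂)] ⊇ [n₁, n₂]`
of `P` would force equality at `an₁ + bn₂`, `affine_subchord_of_eq_chord`). [cite: Israel1979, Thm. I.2.4] -/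
theorem IsTranslationInvariant.sub_mul_lt_varPressureAt_mix_of_lt_at_of_le (h₁ : ω₁.IsTranslationInvariant)
    (h₂ : ω₂.IsTranslationInvariant) {n₁ n₂ : ℝ} (hn₁ : ω₁.density ≤ n₁) (hn : n₁ < n₂) (hn₂ : n₂ ≤ ω₂.density)
    {a b : ℝ} (ha : 0 ≤ a) (hb : 0 ≤ b) (hab : a + b = 1)
    (hstrict : a * Ψ.varPressureAt β R n₁ + b * Ψ.varPressureAt β R n₂ < Ψ.varPressureAt β R (a * n₁ + b * n₂))
    {lam : ℝ} (hl0 : 0 < lam) (hl1 : lam < 1) :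
    (InfVolFermionState.mix lam hl0.le hl1.le ω₁ ω₂).entropyDensitySup - β * (InfVolFermionState.mix lam hl0.le hl1.le ω₁ ω₂).meanEnergy Ψ R <
      Ψ.varPressureAt β R (InfVolFermionState.mix lam hl0.le hl1.le ω₁ ω₂).density := by
  by_contra hle
  have hle' := le_of_not_gt hle
  have haff : ∀ {p q : ℝ}, 0 ≤ p → 0 ≤ q → p + q = 1 →
      Ψ.varPressureAt β R (p * ω₁.density + q * ω₂.density) =
        p * Ψ.varPressureAt β R ω₁.density + q * Ψ.varPressureAt β R ω₂.density :=
    fun hp hq hpq => h₁.varPressureAt_eq_chord_on_segment_of_le_mix hd β Ψ R h₂ hl0 hl1 hle' hp hq hpq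
  have heq := affine_subchord_of_eq_chord (f := Ψ.varPressureAt β R) (by linarith) haff
    hn₁ (by linarith) (by linarith) hn₂ ha hb hab
  exact absurd heq (ne_of_gt hstrict)

include hd in
/-- **Certified super-segment exclusion from pressure windows (model-free, `T ≥ 0`).** A pressure FLOOR `W ≤ P(an₁ + bn₂)` and pressure
CAPS `P(n₁) ≤ Q₁`, `P(n₂) ≤ Q₂` with `aQ₁ + bQ₂ < W` (`a, b ≥ 0`, `a + b = 1`, `n₁ < n₂`) certify: no mixture of translation-invariant
states with densities `ρ(ω₁) ≤ n₁`, `n₂ ≤ ρ(ω₂)` is a canonical equilibrium state at ANY mean density — macroscopic thermal phase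
separation into a phase of density `≤ n₁` and a phase of density `≥ n₂` is excluded at `β`. [cite: Israel1979, Thm. I.2.4] -/
theorem IsTranslationInvariant.sub_mul_lt_varPressureAt_mix_of_caps_lt_floor_of_le (h₁ : ω₁.IsTranslationInvariant)
    (h₂ : ω₂.IsTranslationInvariant) {n₁ n₂ : ℝ} (hn₁ : ω₁.density ≤ n₁) (hn : n₁ < n₂) (hn₂ : n₂ ≤ ω₂.density)
    {a b : ℝ} (ha : 0 ≤ a) (hb : 0 ≤ b) (hab : a + b = 1) {W Q₁ Q₂ : ℝ}
    (hW : W ≤ Ψ.varPressureAt β R (a * n₁ + b * n₂))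
    (hQ₁ : Ψ.varPressureAt β R n₁ ≤ Q₁) (hQ₂ : Ψ.varPressureAt β R n₂ ≤ Q₂) (hlt : a * Q₁ + b * Q₂ < W)
    {lam : ℝ} (hl0 : 0 < lam) (hl1 : lam < 1) :
    (InfVolFermionState.mix lam hl0.le hl1.le ω₁ ω₂).entropyDensitySup - β * (InfVolFermionState.mix lam hl0.le hl1.le ω₁ ω₂).meanEnergy Ψ R <
      Ψ.varPressureAt β R (InfVolFermionState.mix lam hl0.le hl1.le ω₁ ω₂).density := by
  refine h₁.sub_mul_lt_varPressureAt_mix_of_lt_at_of_le hd β Ψ R h₂ hn₁ hn hn₂ ha hb hab ?_ hl0 hl1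
  have k1 := mul_le_mul_of_nonneg_left hQ₁ ha
  have k2 := mul_le_mul_of_nonneg_left hQ₂ hb
  linarith

include hd in
/-- **The free-energy functional of a mixture from certified pressure caps** (`0 ≤ λ ≤ 1`):
`s̄(λω₁ + (1−λ)ω₂) − βe_Ψ(λω₁ + (1−λ)ω₂) ≤ λQ₁ + (1−λ)Q₂` whenever `P(β,Ψ;ρ(ω_i)) ≤ Q_i` (affinity of `s̄` and `e_Ψ` + the trial principle
for each component). With a floor `W ≤ P(ρ(mix))` the phase-separated state lies at least `W − λQ₁ − (1−λ)Q₂` (in pressure units)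
below equilibrium. [cite: Israel1979, Lemma II.3.1] [cite: ArakiMoriya2003, Theorem 3.8 and §10] -/
theorem IsTranslationInvariant.sub_mul_mix_le_convexComb_caps (h₁ : ω₁.IsTranslationInvariant) (h₂ : ω₂.IsTranslationInvariant)
    {Q₁ Q₂ : ℝ} (hQ₁ : Ψ.varPressureAt β R ω₁.density ≤ Q₁) (hQ₂ : Ψ.varPressureAt β R ω₂.density ≤ Q₂)
    {lam : ℝ} (hl0 : 0 ≤ lam) (hl1 : lam ≤ 1) :
    (InfVolFermionState.mix lam hl0 hl1 ω₁ ω₂).entropyDensitySup - β * (InfVolFermionState.mix lam hl0 hl1 ω₁ ω₂).meanEnergy Ψ R ≤ lam * Q₁ + (1 - lam) * Q₂ := by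
  have hv₁ := Ψ.sub_mul_le_varPressureAt β R ω₁.density h₁ rfl
  have hv₂ := Ψ.sub_mul_le_varPressureAt β R ω₂.density h₂ rfl
  rw [entropyDensitySup_mix hd lam hl0 hl1 h₁ h₂, meanEnergy_mix]
  have k1 := mul_le_mul_of_nonneg_left (hv₁.trans hQ₁) hl0
  have k2 := mul_le_mul_of_nonneg_left (hv₂.trans hQ₂) (by linarith : 0 ≤ 1 - lam)
  nlinarith [k1, k2]

end InfVolFermionState

end Literature.MathematicalPhysics.QuantumLattice

end
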